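import Summits.ValiantsHypothesis.ValiantsHypothesis.Theorems.BinomialElusivePeelingLemmaGadgetBlock

/-!
# The block theta gadget (design 3), II: all arms share the branch vectors

Helper for the crux stmt-ValiantsHypothesis-7391 (negative lane; `Cruxes/PeelingLemma/DETERMINISTIC-ALLX.md`
§3e, module [T3]).  With the block age order at `b` and the SAME involution as closing order at `b'`
(`birthNat3`), every arm `j` has the vector `Σ_a (-1)^a e_{beta a}` at position `2q` (`win3_b_beta`,
`win3_b_eq_zero`, `win3_b_eq`) and `Σ_a (-1)^a e_{beta' a}` at position `4q+no+2` (`win3_b'_beta'`,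
`win3_b'_eq_zero`, `win3_b'_eq`) — parity preservation of `blockAge` is all that is needed.  With the
pair-label identity `win_add_win_succ` every edge of the block gadget is an X-output.  No Theses import.
-/

namespace Summit.ValiantsHypothesis.ValiantsHypothesis.Theorems.PeelingLemmaGadget

-- summit = sub-problem name (single-conjunct summit, D-0017 layout), so the namespace repeats it
set_option linter.dupNamespace false

open scoped BigOperators
open Finset
open Summit.ValiantsHypothesis.ValiantsHypothesis.Theorems.PeelingLemmaWindow (win)

variable {q R no : ℕ}

/-- `birth3` at `n - i` for naturals `i ≤ n`. -/
theorem birth3_sub_natCast (j : Fin 5) (n i : ℕ) (hi : i ≤ n) :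
    birth3 q R no j ((n : ℤ) - (i : ℤ)) = birthNat3 q R no j (n - i) := by
  rw [← Nat.cast_sub hi, birth3_natCast]

/-- The window vector of the block gadget at a natural position `n ≥ 2q`, through `birthNat3`. -/
theorem win_birth3_apply (j : Fin 5) (n : ℕ) (hn : 2 * q ≤ n) (ν : GLetter q no) :
    win (birth3 q R no j) q (n : ℤ) ν =
      ∑ i ∈ Finset.range (2 * q + 1), (-1) ^ i * (if birthNat3 q R no j (n - i) = ν then 1 else 0) := by
  unfold win
  refine Finset.sum_congr rfl fun i hi => ?_
  rw [birth3_sub_natCast j n i (by have := Finset.mem_range.mp hi; omega)]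

/-- If the letter `ν` is born at offset `i₀` below position `n`, its coefficient in the window vector
at `n` is `(-1)^{i₀}`. -/
theorem win3_eq_of_hit (j : Fin 5) (n : ℕ) (hn : 2 * q ≤ n) (ν : GLetter q no) (i₀ : ℕ)
    (hi₀ : i₀ ≤ 2 * q) (hit : birthNat3 q R no j (n - i₀) = ν) :
    win (birth3 q R no j) q (n : ℤ) ν = (-1) ^ i₀ := by
  rw [win_birth3_apply j n hn, Finset.sum_eq_single_of_mem i₀ (Finset.mem_range.mpr (by omega))]
  · rw [if_pos hit, mul_one]
  · intro i hi hne
    rw [if_neg, mul_zero]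
    intro h
    have h1 : birth3 q R no j ((n - i : ℕ) : ℤ) = birth3 q R no j ((n - i₀ : ℕ) : ℤ) := by
      rw [birth3_natCast, birth3_natCast, h, hit]
    have h2 := birth3_injective j h1
    have h3 : n - i = n - i₀ := by exact_mod_cast h2
    have := Finset.mem_range.mp hi
    omega

/-- A letter not born in the window below `n` does not occur in the window vector at `n`. -/
theorem win3_eq_zero_of_no_hit (j : Fin 5) (n : ℕ) (hn : 2 * q ≤ n) (ν : GLetter q no)
    (hno : ∀ i ≤ 2 * q, birthNat3 q R no j (n - i) ≠ ν) : win (birth3 q R no j) q (n : ℤ) ν = 0 := by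
  rw [win_birth3_apply j n hn]
  refine Finset.sum_eq_zero fun i hi => ?_
  rw [if_neg (hno i (by have := Finset.mem_range.mp hi; omega)), mul_zero]

/-- **Vertex vector at `b`.**  Every arm sees `beta a` with coefficient `(-1)^a` at position `2q` … -/
theorem win3_b_beta (j : Fin 5) (a : Fin (2 * q + 1)) :
    win (birth3 q R no j) q ((2 * q : ℕ) : ℤ) (GLetter.beta a) = (-1) ^ (a : ℕ) := by
  have hi₀ : ((blockAge q R j a : Fin (2 * q + 1)) : ℕ) ≤ 2 * q := by
    have := (blockAge q R j a).isLt; omega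
  rw [win3_eq_of_hit j (2 * q) le_rfl (GLetter.beta a) _ hi₀]
  · exact neg_one_pow_of_mod_two_eq (blockAge_parity q R j a)
  · rw [birthNat3_beta j (by omega)]
    have : (⟨2 * q - (2 * q - ((blockAge q R j a : Fin (2 * q + 1)) : ℕ)), by omega⟩ : Fin (2 * q + 1))
        = blockAge q R j a := Fin.ext (by simp only; omega)
    rw [this, blockAge_blockAge]

/-- … and no other letter. -/
theorem win3_b_eq_zero (j : Fin 5) (ν : GLetter q no) (hν : ∀ a, ν ≠ GLetter.beta a) :
    win (birth3 q R no j) q ((2 * q : ℕ) : ℤ) ν = 0 := by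
  refine win3_eq_zero_of_no_hit j (2 * q) le_rfl ν fun i hi => ?_
  rw [birthNat3_beta j (by omega)]
  exact fun h => hν _ h.symm

/-- **Vertex vector at `b'`.**  Every arm sees `beta' a` with coefficient `(-1)^a` at position
`4q + no + 2` (the letter `beta' a` is born `2q - blockAge j a` steps before `b'`) … -/
theorem win3_b'_beta' (j : Fin 5) (a : Fin (2 * q + 1)) :
    win (birth3 q R no j) q ((4 * q + no + 2 : ℕ) : ℤ) (GLetter.beta' a) = (-1) ^ (a : ℕ) := by
  have hlt := (blockAge q R j a).isLt
  have hit : birthNat3 q R no j (4 * q + no + 2 - (2 * q - ((blockAge q R j a : Fin (2 * q + 1)) : ℕ)))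
      = GLetter.beta' a := by
    rw [birthNat3_beta' j (by omega) (by omega)]
    have : (⟨4 * q + no + 2 - (2 * q - ((blockAge q R j a : Fin (2 * q + 1)) : ℕ)) - (2 * q + no + 2),
        by omega⟩ : Fin (2 * q + 1)) = blockAge q R j a := Fin.ext (by simp only; omega)
    rw [this, blockAge_blockAge]
  rw [win3_eq_of_hit j _ (by omega) _ (2 * q - ((blockAge q R j a : Fin (2 * q + 1)) : ℕ)) (by omega) hit]
  have hp := blockAge_parity q R j a
  exact neg_one_pow_of_mod_two_eq (by omega)

/-- … and no other letter. -/
theorem win3_b'_eq_zero (j : Fin 5) (ν : GLetter q no) (hν : ∀ a, ν ≠ GLetter.beta' a) :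
    win (birth3 q R no j) q ((4 * q + no + 2 : ℕ) : ℤ) ν = 0 := by
  refine win3_eq_zero_of_no_hit j _ (by omega) ν fun i hi => ?_
  rw [birthNat3_beta' j (by omega) (by omega)]
  exact fun h => hν _ h.symm

/-- **Common branch vectors (block gadget).**  All five arms have the same vertex vector at `b` … -/
theorem win3_b_eq (j j' : Fin 5) :
    win (birth3 q R no j) q ((2 * q : ℕ) : ℤ) = win (birth3 q R no j') q ((2 * q : ℕ) : ℤ) := by
  funext ν
  by_cases h : ∃ a, ν = GLetter.beta a
  · obtain ⟨a, rfl⟩ := h; rw [win3_b_beta, win3_b_beta]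
  · push Not at h; rw [win3_b_eq_zero j ν h, win3_b_eq_zero j' ν h]

/-- … and at `b'`. -/
theorem win3_b'_eq (j j' : Fin 5) :
    win (birth3 q R no j) q ((4 * q + no + 2 : ℕ) : ℤ) =
      win (birth3 q R no j') q ((4 * q + no + 2 : ℕ) : ℤ) := by
  funext ν
  by_cases h : ∃ a, ν = GLetter.beta' a
  · obtain ⟨a, rfl⟩ := h; rw [win3_b'_beta', win3_b'_beta']
  · push Not at h; rw [win3_b'_eq_zero j ν h, win3_b'_eq_zero j' ν h]

end Summit.ValiantsHypothesis.ValiantsHypothesis.Theorems.PeelingLemmaGadget
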